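import Summits.QuantumFields.BalabanUV.Beta.ResolventPermutation
import Literature.MathematicalPhysics.QuantumFieldTheory.Balaban1983to89.Beta.AveragingContoursRooted

/-!
# `BalabanUV.Beta.SymmetrisedAxialPotential` — binder row D1, RULING R-D1-g25-1 (CLAIMS l.24596), step S1: THE PERMUTATION-SYMMETRISED
# AXIAL POTENTIAL AND LINEAR AVERAGING (the linear order of [Balaban1987RG1] (0.3)–(0.4), the contour FAMILY `G(y,x)`), AS THE `S_d`-SUM OF
# THE CELL'S ROOTED COMB OBJECTS IN PERMUTED COORDINATES — exact-form law, translation, the coarse-exact decomposition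
# `symLinAvgAt ρ = d!•contourSum − dz∘SymLamAt ρ`, and THE PERMUTATION COVARIANCE AT A SYMMETRIC ROOT that the single comb lacks

HONEST FRAMING (cell contract, verbatim): «discharging `BetaPertH` makes Bałaban's UV stability UNCONDITIONAL — a real constructive-QFT
result; it is NOT the continuum limit and NOT the Clay problem.»  THIS MODULE DISCHARGES NOTHING of `BetaPertH` ∕ row D1: it is [folklore]
finite re-indexing of lists and box sums on `ℤ^d` (Form level; no kernels, no tables, no estimates).  0 sorry, 0 `def … : Prop`, nothing cited
as a fact; the quotations below are OBJECT LOCATORS only.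

WHY (RULING R-D1-g25-1, DIVERGENCE D-an3g42-1 ∕ D-an2g25-1, GAPS C-an2-81).  The β∕row-D1 literal of record up to gen 24 (`RowD1JointEnd.JsRowD1Pin`,
`SpineRootedBmN.JsBalBmNAtOf`) reads the background through the ONE ordered axial contour `AveragingContours.axial` ([Balaban1984PropagatorsI] (1.7)
p.18; [Balaban1985Averaging] (14) p.19, p.24) rooted at the block centre `AveragingContoursRooted.ctr`.  [Balaban1987RG1] p.252 replaces that
averaging for `d = 4`: «In the previous papers we have used the definition introduced in [12]. This definition has one disadvantage, it is not
symmetric with respect to lattice Euclidean transformations. Preserving this symmetry is very important for the method; therefore it is necessary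
to modify the definition.» — the contours `G(y,x)` are «generated by all such permutations» of the axis order (p.252 L26–34) and (0.4) p.253
averages over `Γ ∈ G(c₋,x)`, `Γ′ ∈ G(c₊,x′)` with the weights `1∕|G(c₋,x)|·1∕|G(c₊,x′)|`.  AT LINEAR ORDER the dependence on `Γ`, `Γ′` is
additive, so (0.4) linearises to [Balaban1984PropagatorsI] (1.8) with the contour potential `A(Γ_{y,x})` replaced by its mean over `G(y,x)`;
and [analysis, R-D1-g25-1 (4)(R1)] that mean equals `(1∕d!)·Σ_{σ∈S_d} A(Γ^σ_{y,x})`, `Γ^σ` = the comb with axis order `σ` (a full order of the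
`d` axes induces one staircase contour; a contour moving `m` axes arises from `d!∕m!` orders).  This file types the UNNORMALISED `S_d`-sums
(no division): `symAxial = Σ_σ axialPerm σ`, `SymLamAt`, `symTreeGaugeAt`, `symLinAvgAt`, and proves: (i) `axialPerm σ A y x` IS the comb
integral of the pulled-back form `P1 σ A` between the pulled-back endpoints (definition by transport along MODULE 2's `psite σ`∕`P1 σ`); (ii)
exact forms: `symAxial (grad f) y x = d!·(f x − f y)`; (iii) **`symAxial (P1 π A) y x = symAxial A (π•y) (π•x)`** — permutation covariance,
by `σ ↦ π σ` re-indexing of `S_d` — whereas `CombPermutationWitness.treeGaugeAt_not_permCovariant` (p230343) certifies the single comb is NOT;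
(iv) the rooted objects are the `σ`-sums of the cell's `LamAt`∕`treeGaugeAt`∕`linAvgAt` taken in `σ`-permuted coordinates (`SymLamAt_eq_sum`,
`symTreeGaugeAt_eq_sum`, `symLinAvgAt_eq_sum` — the dictionary by which FIRST-order comb tables symmetrise by plain summation over `S_d`); (v)
`symLinAvgAt ρ A L μ y = d!·contourSum L A μ y − dz (SymLamAt ρ A L) μ y` — the SAME coarse-exact shape as `linAvgAt_eq_contourSum_sub_dz`,
so the cell's congruence ∕ corrector machinery (`RelInvCongruence*`, `CompositeCorrector*`) applies to the symmetrised slice verbatim; (vi) at a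
root fixed by `π` (e.g. the centre `ctr d L`, all coordinates equal): `SymLamAt`∕`symTreeGaugeAt`∕`symLinAvgAt` are `π`-covariant.
NOT HERE: second-order (BCH) jets of (0.4) — they are `(σ,σ′)`-PAIR tables of the loop words `Γ^σ ∪ [x,x′] ∪ (−Γ′^{σ′}) ∪ (−c)` and are NOT the
`σ`-sums of the comb's second-order tables (R-D1-g25-1 (4)(R1); ask S2 to an1); reflections; any kernel; any identification with Bałaban's
minimisers ∕ propagators ∕ β.  NOT D1, NOT BetaPertH, NOT continuum, NOT Clay.
HONEST DEPENDENCY (verbatim): «continuum YM on T⁴ ⇐ BetaPertH ∧ nine spine estimates (0/9 proved); BetaPertH ⇐ (D1) ∧ (D4) ∧ CAP+tail;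
G-an2-4 gates asym, D1 and NE2/3/4.»  ABSOLUTE RULE (cell, verbatim): «No internally-minted statement may enter as a cited fact. Every
hypothesis is either kernel-proved in this package or a verbatim quotation of a PUBLISHED theorem with page reference.»
Unit `b2b-balaban-beta-an2` gen 25 (row-D1 owner), 2026-08-21.
-/

namespace Summit.QuantumFields.BalabanUV.Beta.SymmetrisedAxialPotential

noncomputable section

open Finset
open scoped BigOperators Nat
open Literature.MathematicalPhysics.QuantumFieldTheory.Balaban1983to89.Beta
open AffineAveraging (Form0 Form1 Site unitVec unitVec_apply dz box toSite contourSum)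
open AveragingContours (grad shift axial axial_sum_grad axial_sum_sub axial_add axial_self segUp segUp_sum blk blk_block
  straightSum straightSum_eq_contourSum)
open AveragingContoursRooted (LamAt linAvgAt treeGaugeAt gammaCAt ctr)
open Summit.QuantumFields.BalabanUV.Beta.KernelPermutation (psite psite_apply psite_symm_apply psite_add psite_sub psite_smul)
open Summit.QuantumFields.BalabanUV.Beta.ResolventPermutation (P0 P1 P0_apply P1_apply psite_unitVec dz_P0 contourSum_P1 sum_box_psite
  psite_block toSite_psite)

variable {d : ℕ}

/-! ## §1 The comb with axis order `σ`, by transport of structure -/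

/-- [our object] **THE COMB INTEGRAL WITH AXIS ORDER `σ`**: `A(Γ^σ_{y,x})`, the integral of `A` along the staircase contour from `y` to `x` that
moves the axes in the order `σ(d−1), …, σ(0)` — DEFINED as the cell's comb integral (`AveragingContours.axial`, order `d−1, …, 0`) of the
pulled-back form `P1 σ A` between the pulled-back endpoints `σ⁻¹•y`, `σ⁻¹•x`. -/
def axialPerm (σ : Equiv.Perm (Fin d)) (A : Form1 d ℝ) (y x : Site d) : ℝ :=
  (axial (P1 σ A) ((psite σ).symm y) ((psite σ).symm x)).sum

/-- [folklore] The identity order gives back the cell's comb integral. -/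
theorem axialPerm_one (A : Form1 d ℝ) (y x : Site d) : axialPerm 1 A y x = (axial A y x).sum := rfl

/-- [folklore] The inverse action is additive (pointwise). -/
theorem psite_symm_add (σ : Equiv.Perm (Fin d)) (x y : Site d) : (psite σ).symm (x + y) = (psite σ).symm x + (psite σ).symm y := rfl

/-- [folklore] The inverse action commutes with integer scalars (pointwise). -/
theorem psite_symm_smul (σ : Equiv.Perm (Fin d)) (c : ℤ) (x : Site d) : (psite σ).symm (c • x) = c • (psite σ).symm x := rfl

/-- [folklore] The inverse action on unit vectors: `σ⁻¹•e_μ = e_{σ⁻¹ μ}`. -/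
theorem psite_symm_unitVec (σ : Equiv.Perm (Fin d)) (μ : Fin d) : (psite σ).symm (unitVec μ) = unitVec (σ.symm μ) := by
  funext i
  simp only [psite_symm_apply, unitVec_apply, Equiv.apply_eq_iff_eq_symm_apply]

/-- [folklore] `blk` commutes with the axis permutation (coordinatewise division). -/
theorem blk_psite (σ : Equiv.Perm (Fin d)) (L : ℕ) (x : Site d) : blk L (psite σ x) = psite σ (blk L x) := rfl

/-- [folklore] `blk` commutes with the inverse action. -/
theorem blk_psite_symm (σ : Equiv.Perm (Fin d)) (L : ℕ) (x : Site d) : blk L ((psite σ).symm x) = (psite σ).symm (blk L x) := rfl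

/-- [folklore] The pull-back of an exact form is exact: `P1 σ (grad f) = grad (P0 σ f)`. -/
theorem P1_grad (σ : Equiv.Perm (Fin d)) (f : Form0 d ℝ) : P1 σ (grad f) = grad (P0 σ f) := by
  funext κ z
  simp only [grad, P1_apply, P0_apply, psite_add, psite_unitVec]

/-- [folklore] **EXACT FORMS**: `A(Γ^σ_{y,x}) = f(x) − f(y)` for `A = grad f`, every order `σ` (every contour from `y` to `x` telescopes). -/
theorem axialPerm_grad (σ : Equiv.Perm (Fin d)) (f : Form0 d ℝ) (y x : Site d) : axialPerm σ (grad f) y x = f x - f y := by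
  simp only [axialPerm, P1_grad, axial_sum_grad, P0_apply, Equiv.apply_symm_apply]

/-- [folklore] Linearity in the form (differences). -/
theorem axialPerm_sub (σ : Equiv.Perm (Fin d)) (A A' : Form1 d ℝ) (y x : Site d) :
    axialPerm σ (A - A') y x = axialPerm σ A y x - axialPerm σ A' y x := by
  have h : P1 σ (A - A') = P1 σ A - P1 σ A' := rfl
  simp only [axialPerm, h, axial_sum_sub]

/-- [folklore] The empty contour. -/
@[simp] theorem axialPerm_self (σ : Equiv.Perm (Fin d)) (A : Form1 d ℝ) (y : Site d) : axialPerm σ A y y = 0 := by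
  simp only [axialPerm, axial_self, List.sum_nil]

/-- [folklore] Pull-back and translation: `P1 σ (shift v A) = shift (σ⁻¹•v) (P1 σ A)`. -/
theorem P1_shift (σ : Equiv.Perm (Fin d)) (v : Site d) (A : Form1 d ℝ) : P1 σ (shift v A) = shift ((psite σ).symm v) (P1 σ A) := by
  funext κ z
  simp only [shift, P1_apply, psite_add, Equiv.apply_symm_apply]

/-- [folklore] Translation covariance: `A(Γ^σ_{y+v,x+v}) = (shift v A)(Γ^σ_{y,x})`. -/
theorem axialPerm_add (σ : Equiv.Perm (Fin d)) (A : Form1 d ℝ) (y x v : Site d) :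
    axialPerm σ A (y + v) (x + v) = axialPerm σ (shift v A) y x := by
  simp only [axialPerm, P1_shift, psite_symm_add, ← axial_add]

/-- [folklore] Composition of pull-backs: `P1 σ (P1 π A) = P1 (π σ) A`. -/
theorem P1_P1 (σ π : Equiv.Perm (Fin d)) (A : Form1 d ℝ) : P1 σ (P1 π A) = P1 (π * σ) A := by
  funext κ z
  simp only [P1_apply, Equiv.Perm.mul_apply]
  rfl

/-- [folklore] **TRANSPORT OF THE ORDER**: the `σ`-comb of the `π`-pulled-back form is the `πσ`-comb of the form at the `π`-moved endpoints. -/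
theorem axialPerm_P1 (σ π : Equiv.Perm (Fin d)) (A : Form1 d ℝ) (y x : Site d) :
    axialPerm σ (P1 π A) y x = axialPerm (π * σ) A (psite π y) (psite π x) := by
  have h : ∀ w : Site d, (psite (π * σ)).symm (psite π w) = (psite σ).symm w := by
    intro w; funext i
    simp only [psite_symm_apply, psite_apply, Equiv.Perm.mul_apply, Equiv.symm_apply_apply]
  simp only [axialPerm, P1_P1, h]

/-! ## §2 The `S_d`-symmetrised contour potential -/

/-- [our object] **THE SYMMETRISED CONTOUR INTEGRAL** `Σ_{σ∈S_d} A(Γ^σ_{y,x})` (UNNORMALISED: `= d!·` the mean over `G(y,x)` of [Balaban1987RG1]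
(0.4) at linear order, R-D1-g25-1 (4)(R1) [analysis]). -/
def symAxial (A : Form1 d ℝ) (y x : Site d) : ℝ := ∑ σ : Equiv.Perm (Fin d), axialPerm σ A y x

/-- [folklore] `|S_d| = d!`. -/
theorem card_perm_fin : Fintype.card (Equiv.Perm (Fin d)) = d ! := by
  rw [Fintype.card_perm, Fintype.card_fin]

/-- [folklore] **EXACT FORMS**: `symAxial (grad f) y x = d!·(f x − f y)`. -/
theorem symAxial_grad (f : Form0 d ℝ) (y x : Site d) : symAxial (grad f) y x = (d ! : ℝ) * (f x - f y) := by
  simp only [symAxial, axialPerm_grad, Finset.sum_const, Finset.card_univ, card_perm_fin, nsmul_eq_mul]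

/-- [folklore] Linearity (differences). -/
theorem symAxial_sub (A A' : Form1 d ℝ) (y x : Site d) : symAxial (A - A') y x = symAxial A y x - symAxial A' y x := by
  simp only [symAxial, axialPerm_sub, Finset.sum_sub_distrib]

/-- [folklore] The empty contour. -/
@[simp] theorem symAxial_self (A : Form1 d ℝ) (y : Site d) : symAxial A y y = 0 := by
  simp only [symAxial, axialPerm_self, Finset.sum_const_zero]

/-- [folklore] Translation covariance. -/
theorem symAxial_add (A : Form1 d ℝ) (y x v : Site d) : symAxial A (y + v) (x + v) = symAxial (shift v A) y x := by
  simp only [symAxial, axialPerm_add]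

/-- [folklore] **PERMUTATION COVARIANCE OF THE SYMMETRISED POTENTIAL**: `symAxial (P1 π A) y x = symAxial A (π•y) (π•x)` — the property the single
comb LACKS (`CombPermutationWitness.treeGaugeAt_not_permCovariant`).  Proof: `axialPerm_P1` + the re-indexing `σ ↦ πσ` of `S_d`. -/
theorem symAxial_P1 (π : Equiv.Perm (Fin d)) (A : Form1 d ℝ) (y x : Site d) :
    symAxial (P1 π A) y x = symAxial A (psite π y) (psite π x) := by
  simp only [symAxial, axialPerm_P1]
  exact Fintype.sum_bijective (fun σ => π * σ) (Group.mulLeft_bijective π) _ _ fun _ => rfl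

/-! ## §3 The rooted block objects: potential `SymLamAt`, tree gauge `symTreeGaugeAt`, linear averaging `symLinAvgAt` -/

/-- [our object] THE SYMMETRISED ROOTED BLOCK POTENTIAL `Σ_{x∈B(y)} Σ_σ A(Γ^σ_{L·y+ρ, x})` (cf. `AveragingContoursRooted.LamAt`). -/
def SymLamAt (ρ : Site d) (A : Form1 d ℝ) (L : ℕ) (y : Site d) : ℝ :=
  ∑ b ∈ box d L, symAxial A ((L : ℤ) • y + ρ) ((L : ℤ) • y + toSite b)

/-- [our object] THE SYMMETRISED ROOTED TREE GAUGE `Σ_σ A(Γ^σ_{root of the block of x, x})` (cf. `AveragingContoursRooted.treeGaugeAt`). -/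
def symTreeGaugeAt (ρ : Site d) (A : Form1 d ℝ) (L : ℕ) (x : Site d) : ℝ :=
  symAxial A ((L : ℤ) • blk L x + ρ) x

/-- [our object] THE SYMMETRISED ROOTED LINEAR AVERAGING (UNNORMALISED by `d!` and by the block volume): for the coarse bond `c = ⟨y, y + e_μ⟩`,
`Σ_{x∈B(y)} [Σ_σ A(Γ^σ_{r,x}) + d!·A([x, x + L e_μ]) − Σ_σ A(Γ^σ_{r + L e_μ, x + L e_μ})]`, `r = L·y + ρ` — the linear order of [Balaban1987RG1]
(0.4) with independent means over `Γ` and `Γ′` (additive at linear order), times `d!`, in the rooted form of [Balaban1984PropagatorsI] (1.8)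
(cf. `AveragingContoursRooted.linAvgAt` = the single-comb case). -/
def symLinAvgAt (ρ : Site d) (A : Form1 d ℝ) (L : ℕ) (μ : Fin d) (y : Site d) : ℝ :=
  ∑ b ∈ box d L, (symAxial A ((L : ℤ) • y + ρ) ((L : ℤ) • y + toSite b) + (d ! : ℝ) * (segUp A ((L : ℤ) • y + toSite b) μ L).sum
    - symAxial A ((L : ℤ) • y + ρ + (L : ℤ) • unitVec μ) ((L : ℤ) • y + toSite b + (L : ℤ) • unitVec μ))

/-- [folklore] **THE COARSE-EXACT DECOMPOSITION** (mirror of `AveragingContoursRooted.linAvgAt_eq_contourSum_sub_dz`): the symmetrised rooted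
averaging is `d!` times the straight block-contour sum [Balaban1984PropagatorsI] (1.11) MINUS the coarse gradient of the symmetrised block
potential — the same shape the cell's congruence ∕ corrector machinery consumes. -/
theorem symLinAvgAt_eq_contourSum_sub_dz (ρ : Site d) (A : Form1 d ℝ) (L : ℕ) (μ : Fin d) (y : Site d) :
    symLinAvgAt ρ A L μ y = (d ! : ℝ) * contourSum L A μ y - dz (SymLamAt ρ A L) μ y := by
  have hc : (L : ℤ) • y + ρ + (L : ℤ) • unitVec μ = (L : ℤ) • (y + unitVec μ) + ρ := by rw [smul_add]; abel
  have hx : ∀ b : Fin d → ℕ, (L : ℤ) • y + toSite b + (L : ℤ) • unitVec μ = (L : ℤ) • (y + unitVec μ) + toSite b := by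
    intro b; rw [smul_add]; abel
  simp only [symLinAvgAt, SymLamAt, dz, hc, hx, Finset.sum_add_distrib, Finset.sum_sub_distrib, ← Finset.mul_sum,
    ← straightSum_eq_contourSum, straightSum]
  abel

/-- [folklore] **EXACT FORMS** (the Ward input, [Balaban1984PropagatorsI] (1.9) shape): on `A = grad f` the symmetrised rooted averaging is
`d!·#B·(f(r + L e_μ) − f(r))`, `r = L·y + ρ` — it sees `f` only at the ROOTS. -/
theorem symLinAvgAt_grad (ρ : Site d) (f : Form0 d ℝ) (L : ℕ) (μ : Fin d) (y : Site d) :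
    symLinAvgAt ρ (grad f) L μ y
      = (d ! : ℝ) * (box d L).card * (f ((L : ℤ) • y + ρ + (L : ℤ) • unitVec μ) - f ((L : ℤ) • y + ρ)) := by
  have hseg : ∀ b : Fin d → ℕ, (segUp (grad f) ((L : ℤ) • y + toSite b) μ L).sum
      = f ((L : ℤ) • y + toSite b + (L : ℤ) • unitVec μ) - f ((L : ℤ) • y + toSite b) := fun b =>
    AveragingContours.segUp_sum_grad f _ μ L
  have hterm : ∀ b ∈ box d L,
      symAxial (grad f) ((L : ℤ) • y + ρ) ((L : ℤ) • y + toSite b) + (d ! : ℝ) * (segUp (grad f) ((L : ℤ) • y + toSite b) μ L).sum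
        - symAxial (grad f) ((L : ℤ) • y + ρ + (L : ℤ) • unitVec μ) ((L : ℤ) • y + toSite b + (L : ℤ) • unitVec μ)
        = (d ! : ℝ) * (f ((L : ℤ) • y + ρ + (L : ℤ) • unitVec μ) - f ((L : ℤ) • y + ρ)) := by
    intro b _
    rw [symAxial_grad, symAxial_grad, hseg]
    ring
  rw [symLinAvgAt, Finset.sum_congr rfl hterm, Finset.sum_const, nsmul_eq_mul]
  ring

/-- [folklore] Gauge law: under `A ↦ A − grad λ` the symmetrised rooted averaging changes by `d!·#B` times the coarse gradient of `λ` on the roots. -/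
theorem symLinAvgAt_gauge (ρ : Site d) (A : Form1 d ℝ) (lam : Form0 d ℝ) (L : ℕ) (μ : Fin d) (y : Site d) :
    symLinAvgAt ρ (A - grad lam) L μ y
      = symLinAvgAt ρ A L μ y
        - (d ! : ℝ) * (box d L).card * (lam ((L : ℤ) • y + ρ + (L : ℤ) • unitVec μ) - lam ((L : ℤ) • y + ρ)) := by
  rw [← symLinAvgAt_grad ρ lam L μ y]
  have hseg : ∀ b : Fin d → ℕ, (segUp (A - grad lam) ((L : ℤ) • y + toSite b) μ L).sum
      = (segUp A ((L : ℤ) • y + toSite b) μ L).sum - (segUp (grad lam) ((L : ℤ) • y + toSite b) μ L).sum := fun b =>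
    AveragingContours.segUp_sum_sub A (grad lam) _ μ L
  simp only [symLinAvgAt, symAxial_sub, hseg, mul_sub, ← Finset.sum_sub_distrib]
  refine Finset.sum_congr rfl fun b _ => ?_
  ring

/-! ### The dictionary with the comb objects: `σ`-sums in permuted coordinates (first-order tables symmetrise by summation) -/

/-- [folklore] `SymLamAt ρ A L y = Σ_σ LamAt (σ⁻¹•ρ) (P1 σ A) L (σ⁻¹•y)`. -/
theorem SymLamAt_eq_sum (ρ : Site d) (A : Form1 d ℝ) (L : ℕ) (y : Site d) :
    SymLamAt ρ A L y = ∑ σ : Equiv.Perm (Fin d), LamAt ((psite σ).symm ρ) (P1 σ A) L ((psite σ).symm y) := by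
  simp only [SymLamAt, symAxial, LamAt]
  rw [Finset.sum_comm]
  refine Finset.sum_congr rfl fun σ _ => ?_
  rw [← sum_box_psite σ L (fun b => axialPerm σ A ((L : ℤ) • y + ρ) ((L : ℤ) • y + toSite b))]
  refine Finset.sum_congr rfl fun b _ => ?_
  simp only [axialPerm, toSite_psite, psite_symm_add, psite_symm_smul, Equiv.symm_apply_apply]

/-- [folklore] `symTreeGaugeAt ρ A L x = Σ_σ treeGaugeAt (σ⁻¹•ρ) (P1 σ A) L (σ⁻¹•x)`. -/
theorem symTreeGaugeAt_eq_sum (ρ : Site d) (A : Form1 d ℝ) (L : ℕ) (x : Site d) :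
    symTreeGaugeAt ρ A L x = ∑ σ : Equiv.Perm (Fin d), treeGaugeAt ((psite σ).symm ρ) (P1 σ A) L ((psite σ).symm x) := by
  simp only [symTreeGaugeAt, symAxial, treeGaugeAt, axialPerm]
  refine Finset.sum_congr rfl fun σ _ => ?_
  rw [psite_symm_add, psite_symm_smul, blk_psite_symm]

/-- [folklore] Straight segments are read covariantly: the `σ⁻¹μ`-segment of `P1 σ A` from `σ⁻¹•x` is the `μ`-segment of `A` from `x`. -/
theorem segUp_sum_P1 (σ : Equiv.Perm (Fin d)) (A : Form1 d ℝ) (x : Site d) (μ : Fin d) (n : ℕ) :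
    (segUp (P1 σ A) ((psite σ).symm x) (σ.symm μ) n).sum = (segUp A x μ n).sum := by
  simp only [segUp_sum, P1_apply, psite_add, psite_smul, psite_unitVec, Equiv.apply_symm_apply]

/-- [folklore] **THE FIRST-ORDER DICTIONARY**: `symLinAvgAt ρ A L μ y = Σ_σ linAvgAt (σ⁻¹•ρ) (P1 σ A) L (σ⁻¹ μ) (σ⁻¹•y)` — the symmetrised
rooted averaging IS the sum over the axis orders of the cell's single-comb rooted averaging read in `σ`-permuted coordinates (so every table
that is LINEAR in the contour symmetrises by summation over `S_d`; [analysis] second-order tables do NOT, see the header). -/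
theorem symLinAvgAt_eq_sum (ρ : Site d) (A : Form1 d ℝ) (L : ℕ) (μ : Fin d) (y : Site d) :
    symLinAvgAt ρ A L μ y
      = ∑ σ : Equiv.Perm (Fin d), linAvgAt ((psite σ).symm ρ) (P1 σ A) L (σ.symm μ) ((psite σ).symm y) := by
  have hlin : ∀ σ : Equiv.Perm (Fin d), linAvgAt ((psite σ).symm ρ) (P1 σ A) L (σ.symm μ) ((psite σ).symm y)
      = ∑ b ∈ box d L, (axialPerm σ A ((L : ℤ) • y + ρ) ((L : ℤ) • y + toSite b) + (segUp A ((L : ℤ) • y + toSite b) μ L).sum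
          - axialPerm σ A ((L : ℤ) • y + ρ + (L : ℤ) • unitVec μ) ((L : ℤ) • y + toSite b + (L : ℤ) • unitVec μ)) := by
    intro σ
    simp only [linAvgAt]
    rw [← sum_box_psite σ L (fun b => axialPerm σ A ((L : ℤ) • y + ρ) ((L : ℤ) • y + toSite b)
      + (segUp A ((L : ℤ) • y + toSite b) μ L).sum
      - axialPerm σ A ((L : ℤ) • y + ρ + (L : ℤ) • unitVec μ) ((L : ℤ) • y + toSite b + (L : ℤ) • unitVec μ))]
    refine Finset.sum_congr rfl fun b _ => ?_
    have hx : (psite σ).symm ((L : ℤ) • y + toSite (psite σ b)) = (L : ℤ) • (psite σ).symm y + toSite b := by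
      rw [psite_symm_add, psite_symm_smul, toSite_psite, Equiv.symm_apply_apply]
    have hr : (psite σ).symm ((L : ℤ) • y + ρ) = (L : ℤ) • (psite σ).symm y + (psite σ).symm ρ := by
      rw [psite_symm_add, psite_symm_smul]
    have hre : (psite σ).symm ((L : ℤ) • y + ρ + (L : ℤ) • unitVec μ)
        = (L : ℤ) • (psite σ).symm y + (psite σ).symm ρ + (L : ℤ) • unitVec (σ.symm μ) := by
      rw [psite_symm_add, psite_symm_add, psite_symm_smul, psite_symm_smul, psite_symm_unitVec]
    have hxe : (psite σ).symm ((L : ℤ) • y + toSite (psite σ b) + (L : ℤ) • unitVec μ)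
        = (L : ℤ) • (psite σ).symm y + toSite b + (L : ℤ) • unitVec (σ.symm μ) := by
      rw [psite_symm_add, psite_symm_add, psite_symm_smul, psite_symm_smul, psite_symm_unitVec, toSite_psite,
        Equiv.symm_apply_apply]
    rw [gammaCAt, List.sum_append, List.sum_append, AveragingContours.rev_sum, ← segUp_sum_P1 σ A ((L : ℤ) • y + toSite (psite σ b)) μ L]
    simp only [axialPerm, hx, hr, hre, hxe]
    abel
  simp only [hlin, symLinAvgAt, symAxial]
  rw [Finset.sum_comm]
  refine Finset.sum_congr rfl fun b _ => ?_
  rw [Finset.sum_sub_distrib, Finset.sum_add_distrib, Finset.sum_const, Finset.card_univ, card_perm_fin, nsmul_eq_mul]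

/-! ## §4 Permutation covariance of the rooted objects at a symmetric root -/

/-- [folklore] The centre is fixed by every axis permutation (all its coordinates are equal). -/
@[simp] theorem psite_ctr (π : Equiv.Perm (Fin d)) (L : ℕ) : psite π (ctr d L) = ctr d L := rfl

/-- [folklore] **COVARIANCE OF THE SYMMETRISED BLOCK POTENTIAL** at a `π`-fixed root: `SymLamAt ρ (P1 π A) L y = SymLamAt ρ A L (π•y)`. -/
theorem SymLamAt_P1 {ρ : Site d} {π : Equiv.Perm (Fin d)} (hρ : psite π ρ = ρ) (A : Form1 d ℝ) (L : ℕ) (y : Site d) :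
    SymLamAt ρ (P1 π A) L y = SymLamAt ρ A L (psite π y) := by
  simp only [SymLamAt, symAxial_P1, psite_add, psite_smul, hρ]
  rw [← sum_box_psite π L (fun b => symAxial A ((L : ℤ) • psite π y + ρ) ((L : ℤ) • psite π y + toSite b))]
  simp only [toSite_psite]

/-- [folklore] The same as an identity of block functions: `SymLamAt ρ (P1 π A) L = P0 π (SymLamAt ρ A L)`. -/
theorem SymLamAt_P1_eq {ρ : Site d} {π : Equiv.Perm (Fin d)} (hρ : psite π ρ = ρ) (A : Form1 d ℝ) (L : ℕ) :
    SymLamAt ρ (P1 π A) L = P0 π (SymLamAt ρ A L) := by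
  funext y; rw [SymLamAt_P1 hρ, P0_apply]

/-- [folklore] **COVARIANCE OF THE SYMMETRISED TREE GAUGE** at a `π`-fixed root: `symTreeGaugeAt ρ (P1 π A) L x = symTreeGaugeAt ρ A L (π•x)` —
contrast `CombPermutationWitness.treeGaugeAt_not_permCovariant` for the single comb at the centred root. -/
theorem symTreeGaugeAt_P1 {ρ : Site d} {π : Equiv.Perm (Fin d)} (hρ : psite π ρ = ρ) (A : Form1 d ℝ) (L : ℕ) (x : Site d) :
    symTreeGaugeAt ρ (P1 π A) L x = symTreeGaugeAt ρ A L (psite π x) := by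
  simp only [symTreeGaugeAt, symAxial_P1, psite_add, psite_smul, hρ, blk_psite]

/-- [folklore] **COVARIANCE OF THE SYMMETRISED ROOTED AVERAGING** at a `π`-fixed root: the `μ`-component at `y` of the average of `P1 π A` is the
`π μ`-component at `π•y` of the average of `A`. -/
theorem symLinAvgAt_P1 {ρ : Site d} {π : Equiv.Perm (Fin d)} (hρ : psite π ρ = ρ) (A : Form1 d ℝ) (L : ℕ) (μ : Fin d) (y : Site d) :
    symLinAvgAt ρ (P1 π A) L μ y = symLinAvgAt ρ A L (π μ) (psite π y) := by
  rw [symLinAvgAt_eq_contourSum_sub_dz, symLinAvgAt_eq_contourSum_sub_dz, contourSum_P1, P1_apply, SymLamAt_P1_eq hρ, dz_P0, P1_apply]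

/-- [folklore] AT THE CENTRED ROOT (the cell's root of record, [Balaban1987RG1] (0.3) «a cube with a center at y»): the symmetrised tree gauge
is permutation-covariant for EVERY `π ∈ S_d`. -/
theorem symTreeGaugeAt_ctr_P1 (π : Equiv.Perm (Fin d)) (A : Form1 d ℝ) (L : ℕ) (x : Site d) :
    symTreeGaugeAt (ctr d L) (P1 π A) L x = symTreeGaugeAt (ctr d L) A L (psite π x) :=
  symTreeGaugeAt_P1 (psite_ctr π L) A L x

/-- [folklore] AT THE CENTRED ROOT: the symmetrised rooted averaging is permutation-covariant for EVERY `π ∈ S_d`. -/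
theorem symLinAvgAt_ctr_P1 (π : Equiv.Perm (Fin d)) (A : Form1 d ℝ) (L : ℕ) (μ : Fin d) (y : Site d) :
    symLinAvgAt (ctr d L) (P1 π A) L μ y = symLinAvgAt (ctr d L) A L (π μ) (psite π y) :=
  symLinAvgAt_P1 (psite_ctr π L) A L μ y

end

end Summit.QuantumFields.BalabanUV.Beta.SymmetrisedAxialPotential
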